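import Mathlib.Analysis.Calculus.UniformLimitsDeriv
import Literature.Analysis.FluidPDE.NewtonNearCZ
import Literature.Analysis.FluidPDE.KernelSideDifferentiation
import HarnessLib

/-!
# The gradient potential of the near-field Newtonian kernel of a Hölder density is `C¹`,
with derivative the singular integral on differences

Analysis/FluidPDE support file on the discharge path of the named fact
`Literature.Analysis.FluidPDE.MajdaBertozzi2002_holderEulerLocalExistence`
(`ElgindiBlowupContinuationProofs.lean`; Lagrangian decomposition `HolderEulerLagrangian.lean`).
For the compactly supported near part `Γ₀ = θΓ = newtonNear r₀ r₁` of the Newtonian kernel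
(`NewtonKernel.lean`, `NewtonNearDerivatives.lean`) and a direction `a`, the **near gradient
potential** of a density `f : ℝ³ → F`,

  `T⁰_a f (x) = ∫ ∂_aΓ₀(x − y) • f(y) dy`  (`newtonNearGradPotential r₀ r₁ a f x`),

is the near part of `∂_a(Γ ⋆ f)`; this file proves that for a `γ`-Hölder `f`, `0 < γ < 1`, it
is continuously differentiable with

  `D(T⁰_a f)(x) b = ∫ ∂_b∂_aΓ₀(x − y) • (f(y) − f(x)) dy = czDiff (newtonNearHess r₀ r₁ a b) f x`

(Gilbarg–Trudinger 2001, Lemma 4.2 with (4.10), in the sphere-free form of the tree: the smooth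
cutoff produces no boundary term), the right-hand side being the Hölder continuous singular
integral of `HolderCZKernel.lean`/`NewtonNearCZ.lean` (Majda–Bertozzi, *Vorticity and
Incompressible Flow*, CUP 2002, §4.1.3 Lemma 4.6, p. 129 of the held text). Proof
(regularisation, as in Gilbarg–Trudinger's proof of Lemma 4.2): the truncated kernels
`G_d = (1 − θ₂₃(·/d)) ∂_aΓ₀ ∈ C¹_c` (`newtonNearGradTrunc`; the truncation calculus is
`NewtonNearTruncation.lean` with `w = 0`) give potentials `u_d = ∫ G_d(x − y) • f(y) dy` with
`∂_b u_d(x) = ∫ ∂_bG_d(x − y) • (f(y) − f(x)) dy` (kernel-side differentiation,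
`KernelSideDifferentiation.lean`, and `∫ ∂_bG_d = 0`); since `∂_bG_d − ∂_b∂_aΓ₀` lives on
`|z| ≤ 3d` with size `≲ d⁻¹|z|⁻² + |z|⁻³`, one gets `sup_x ‖∂_b u_d(x) − S_{ab}f(x)‖ ≲ ‖b‖ d^γ`,
while `u_d → T⁰_a f` pointwise (`≲ d`); Mathlib's `hasFDerivAt_of_tendstoUniformly` (uniform
convergence of the derivatives, pointwise convergence of the functions) along `d = 1/(n+1)`
concludes.

## Contents

* `newtonNearGradTrunc`, its `C¹_c` regularity, derivative formula, vanishing of `∫ ∂_bG_d`,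
  and the error kernel bound `|∂_bG_d(z) − ∂_b∂_aΓ₀(z)| ≤ 1_{|z|<4d}(M_θ d⁻¹‖b‖C₁‖a‖|z|⁻² +
  C₂‖a‖‖b‖|z|⁻³)`;
* `newtonNearGradPotential` (`T⁰_a f`) and `newtonNearGradPotentialDeriv` (the continuous linear
  map `b ↦ S_{ab}f(x)`, defined through the standard basis and identified with `czDiff` in
  `newtonNearGradPotentialDeriv_apply`);
* `hasFDerivAt_newtonNearGradPotential`, `contDiff_one_newtonNearGradPotential`, and the bounds
  `exists_newtonNearGradPotential_bounds`: `‖T⁰_a f‖_∞ ≤ C‖a‖‖f‖_∞ r₁`,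
  `‖D T⁰_a f(x)‖ ≤ C‖a‖C_f r₁^γ/γ`, `‖D T⁰_a f(x) − D T⁰_a f(x̄)‖ ≤ C‖a‖C_f(γ⁻¹+(1−γ)⁻¹+1)|x−x̄|^γ`
  — the near half of Majda–Bertozzi's (4.38)–(4.39) `|K₃f|_{1,γ} ≤ c‖f‖_γ`.

## Mathlib / tree search

Tree (all used): `newtonNearGrad`, `newtonNearHess`, `exists_abs_newtonNearGrad_le`,
`exists_abs_newtonNearHess_le`, `integrable_newtonNearGrad`, `newtonNearGrad_eq_zero_of_le`
(`NewtonNearDerivatives`); the truncation lemmas of `NewtonNearTruncation`; `czDiff`,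
`IsHolderCZKernel.integrable_czDiff`, `lintegral_ball_norm_sub_rpow`,
`norm_integral_le_of_indicator_ball` (`HolderCZKernel`); `exists_isHolderCZKernel_newtonNearHess`,
`exists_holder_bounds_czDiff_newtonNearHess` (`NewtonNearCZ`);
`hasFDerivAt_integral_kernel_sub_smul`, `fderiv_integral_kernel_sub_smul_apply`,
`integrable_kernel_sub_smul` (`KernelSideDifferentiation`); `lintegral_ball_norm_rpow_neg`,
`lintegral_ball_comp_sub_left` (`NewtonPotentialHolder`). Mathlib:
`hasFDerivAt_of_tendstoUniformly`, `ContinuousLinearMap.opNorm_le_bound`, `EuclideanSpace.proj`,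
`integral_fderiv_apply_eq_zero` is the tree's (`WholeSpaceIBP`).

## References

* D. Gilbarg, N. S. Trudinger, *Elliptic Partial Differential Equations of Second Order*
  (2001), Lemma 4.2 (proof, cutoff `η_ε`) and (4.10). [GilbargTrudinger2001]
* A. J. Majda, A. L. Bertozzi, *Vorticity and Incompressible Flow* (CUP 2002), §4.1.3
  (4.38)–(4.39), Lemma 4.6, p. 129. [MajdaBertozziCUP2002]
-/

noncomputable section

open MeasureTheory Set Function Filter Metric Real
open _root_.Topology
open scoped NNReal ENNReal

namespace Literature.Analysis.FluidPDE

open NewtonPotentialHolder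

/-- Local notation for physical space `ℝ³ = EuclideanSpace ℝ (Fin 3)`. -/
local notation "ℝ³" => EuclideanSpace ℝ (Fin 3)

variable {F : Type*} [NormedAddCommGroup F] [NormedSpace ℝ F]
variable {r₀ r₁ : ℝ}

/-! ### The truncated gradient kernels `G_d = (1 − θ₂₃(·/d)) ∂_aΓ₀` -/

/-- **The truncated gradient kernel** `G_d(z) = (1 − θ₂₃(d⁻¹z)) ∂_aΓ₀(z)` (`θ₂₃ = radialCutoff 2 3`):
a `C¹` compactly supported regularisation of `∂_aΓ₀`, equal to it for `|z| ≥ 3d` and to `0` for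
`|z| ≤ 2d` (Gilbarg–Trudinger's `D_iΓ η_ε` in the proof of Lemma 4.2). Written with `z + 0` so
that the truncation calculus of `NewtonNearTruncation.lean` (shift `w = 0`) applies verbatim.
[cite: GilbargTrudinger2001, Lemma 4.2 (proof)] -/
def newtonNearGradTrunc (r₀ r₁ d : ℝ) (a z : ℝ³) : ℝ :=
  (1 - radialCutoff 2 3 (d⁻¹ • (z + 0))) * newtonNearGrad r₀ r₁ a z

section Trunc

variable {d : ℝ}

/-- The shift `w = 0` satisfies `‖w‖ ≤ d` for `d > 0`. [folklore] -/
theorem norm_zero_le_of_pos (hd : 0 < d) : ‖(0 : ℝ³)‖ ≤ d := by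
  rw [norm_zero]; exact hd.le

/-- `G_d` is `C¹`. [folklore] -/
theorem contDiff_newtonNearGradTrunc (h₀ : 0 < r₀) (h₁ : r₀ < r₁) (hd : 0 < d) (a : ℝ³) :
    ContDiff ℝ 1 (newtonNearGradTrunc r₀ r₁ d a) :=
  contDiff_truncation_mul_newtonNearGrad h₀ h₁ hd (norm_zero_le_of_pos hd) a

/-- `G_d` has compact support. [folklore] -/
theorem hasCompactSupport_newtonNearGradTrunc (h₀ : 0 < r₀) (h₁ : r₀ < r₁) (d : ℝ) (a : ℝ³) :
    HasCompactSupport (newtonNearGradTrunc r₀ r₁ d a) :=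
  hasCompactSupport_truncation_mul_newtonNearGrad h₀ h₁ 0 d a

/-- `G_d(z) = 0` for `|z| > r₁`. [folklore] -/
theorem newtonNearGradTrunc_eq_zero_of_lt (h₀ : 0 < r₀) (h₁ : r₀ < r₁) (d : ℝ) (a : ℝ³) {z : ℝ³}
    (hz : r₁ < ‖z‖) : newtonNearGradTrunc r₀ r₁ d a z = 0 := by
  rw [newtonNearGradTrunc, newtonNearGrad_eq_zero_of_lt h₀.le h₁ a hz, mul_zero]

/-- **The derivative of `G_d`**: `∂_bG_d = (∂_bχ_d) ∂_aΓ₀ + χ_d ∂_b∂_aΓ₀` at every point. [folklore] -/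
theorem fderiv_newtonNearGradTrunc_apply (hd : 0 < d) (a b z : ℝ³) :
    fderiv ℝ (newtonNearGradTrunc r₀ r₁ d a) z b =
      fderiv ℝ (fun z : ℝ³ => 1 - radialCutoff 2 3 (d⁻¹ • (z + 0))) z b *
          newtonNearGrad r₀ r₁ a z +
        (1 - radialCutoff 2 3 (d⁻¹ • (z + 0))) * newtonNearHess r₀ r₁ a b z :=
  fderiv_truncation_mul_newtonNearGrad_apply hd (norm_zero_le_of_pos hd) a b z

/-- **`∫ ∂_bG_d = 0`** (a `C¹` compactly supported function). [folklore] -/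
theorem integral_fderiv_newtonNearGradTrunc_apply (h₀ : 0 < r₀) (h₁ : r₀ < r₁) (hd : 0 < d)
    (a b : ℝ³) : ∫ z, fderiv ℝ (newtonNearGradTrunc r₀ r₁ d a) z b = 0 :=
  integral_fderiv_apply_eq_zero (contDiff_newtonNearGradTrunc h₀ h₁ hd a)
    (hasCompactSupport_newtonNearGradTrunc h₀ h₁ d a) b

/-- **The error kernel** `∂_bG_d − ∂_b∂_aΓ₀ = (∂_bχ_d) ∂_aΓ₀ − θ₂₃(d⁻¹·) ∂_b∂_aΓ₀`. [folklore] -/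
theorem fderiv_newtonNearGradTrunc_sub_newtonNearHess (hd : 0 < d) (a b z : ℝ³) :
    fderiv ℝ (newtonNearGradTrunc r₀ r₁ d a) z b - newtonNearHess r₀ r₁ a b z =
      fderiv ℝ (fun z : ℝ³ => 1 - radialCutoff 2 3 (d⁻¹ • (z + 0))) z b *
          newtonNearGrad r₀ r₁ a z -
        radialCutoff 2 3 (d⁻¹ • (z + 0)) * newtonNearHess r₀ r₁ a b z := by
  rw [fderiv_newtonNearGradTrunc_apply hd]
  ring

/-- **Size and support of the error kernel**:
`|∂_bG_d(z) − ∂_b∂_aΓ₀(z)| ≤ 1_{|z| < 4d} (M_θ d⁻¹ ‖b‖ C₁‖a‖ |z|⁻² + C₂‖a‖‖b‖|z|⁻³)`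
(both pieces vanish for `|z| > 3d`, where `χ_d ≡ 1` and `θ₂₃(d⁻¹z) = 0`). [folklore] -/
theorem abs_fderiv_newtonNearGradTrunc_sub_newtonNearHess_le (hd : 0 < d) {M C₁ C₂ : ℝ}
    (hM : ∀ u : ℝ³, ‖fderiv ℝ (radialCutoff 2 3 : ℝ³ → ℝ) u‖ ≤ M)
    (hC₁ : ∀ a z : ℝ³, |newtonNearGrad r₀ r₁ a z| ≤ C₁ * ‖a‖ * ‖z‖ ^ (-(2 : ℝ)))
    (hC₂ : ∀ a b z : ℝ³, |newtonNearHess r₀ r₁ a b z| ≤ C₂ * ‖a‖ * ‖b‖ * ‖z‖ ^ (-(3 : ℝ)))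
    (a b z : ℝ³) :
    |fderiv ℝ (newtonNearGradTrunc r₀ r₁ d a) z b - newtonNearHess r₀ r₁ a b z| ≤
      (ball (0 : ℝ³) (4 * d)).indicator (fun z => M * d⁻¹ * ‖b‖ * (C₁ * ‖a‖ * ‖z‖ ^ (-(2 : ℝ))) +
        C₂ * ‖a‖ * ‖b‖ * ‖z‖ ^ (-(3 : ℝ))) z := by
  rw [fderiv_newtonNearGradTrunc_sub_newtonNearHess hd]
  by_cases hz : z ∈ ball (0 : ℝ³) (4 * d)
  · rw [indicator_of_mem hz]
    refine (abs_sub _ _).trans (add_le_add ?_ ?_)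
    · rw [abs_mul]
      exact mul_le_mul (abs_fderiv_truncation_le hd hM z b) (hC₁ a z) (abs_nonneg _)
        (by
          have := hM 0
          have : 0 ≤ M := (norm_nonneg _).trans this
          positivity)
    · rw [abs_mul]
      calc |radialCutoff 2 3 (d⁻¹ • (z + 0))| * |newtonNearHess r₀ r₁ a b z|
          ≤ 1 * (C₂ * ‖a‖ * ‖b‖ * ‖z‖ ^ (-(3 : ℝ))) :=
            mul_le_mul (abs_radialCutoff_le_one 2 3 _) (hC₂ a b z) (abs_nonneg _) zero_le_one
        _ = C₂ * ‖a‖ * ‖b‖ * ‖z‖ ^ (-(3 : ℝ)) := one_mul _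
  · rw [indicator_of_notMem hz]
    rw [mem_ball_zero_iff, not_lt] at hz
    have hz3 : 3 * d < ‖z + 0‖ := by rw [add_zero]; linarith
    rw [fderiv_truncation_eq_zero hd (Or.inr hz3), zero_apply, zero_mul, zero_sub, abs_neg,
      radialCutoff_eq_zero (by norm_num) (by norm_num) ?_, zero_mul, abs_zero]
    rw [norm_smul_add_eq hd, le_inv_mul_iff₀ hd]
    linarith

end Trunc

/-! ### Radial integral with the weight `|z|^{γ−2}` -/

/-- `∫⁻_{B(p,r)} |p − y|^{γ−2} dy = 3|B₁| r^{γ+1}/(γ+1)` (`0 < γ + 1`, i.e. always for `γ ≥ 0`;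
`0 < r`). [folklore] -/
theorem lintegral_ball_norm_sub_rpow_sub_two {γ' : ℝ} (hγ : -1 < γ') (p : ℝ³) {r : ℝ}
    (hr : 0 < r) :
    ∫⁻ y in ball p r, ENNReal.ofReal (‖p - y‖ ^ (γ' - 2)) =
      ENNReal.ofReal (3 * (volume : Measure ℝ³).real (ball 0 1) * (r ^ (γ' + 1) / (γ' + 1))) := by
  have hs : (2 : ℝ) - γ' < 3 := by linarith
  have e1 : ∀ z : ℝ³, ‖z‖ ^ (γ' - 2) = ‖z‖ ^ (-(2 - γ')) := fun z => by rw [neg_sub]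
  rw [lintegral_ball_comp_sub_left (fun z => ENNReal.ofReal (‖z‖ ^ (γ' - 2))) p r]
  simp_rw [e1]
  rw [lintegral_ball_norm_rpow_neg hs hr]
  ring_nf

/-! ### The near gradient potential and the regularised potentials -/

/-- **The near gradient potential** `T⁰_a f (x) = ∫ ∂_aΓ₀(x − y) • f(y) dy` — the near part of
`∂_a(Γ ⋆ f)(x) = ∫ ∂_aΓ(x − y) f(y) dy` (Gilbarg–Trudinger (4.9)/Lemma 4.1; Majda–Bertozzi's
`K₃ f`, (4.29), is a fixed combination of these with `f` the components of the vorticity).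
Bochner integral; it converges for continuous `f` (`integrable_newtonNearGradPotential`). [cite: GilbargTrudinger2001, Lemma 4.1 with (4.9)] -/
def newtonNearGradPotential (r₀ r₁ : ℝ) (a : ℝ³) (f : ℝ³ → F) (x : ℝ³) : F :=
  ∫ y, newtonNearGrad r₀ r₁ a (x - y) • f y

/-- **The candidate derivative** of `T⁰_a f` at `x`: the continuous linear map
`b ↦ Σᵢ bᵢ S_{a eᵢ}f(x)`, `S_{ab}f = czDiff (newtonNearHess r₀ r₁ a b) f` — equal to
`b ↦ S_{ab}f(x)` by linearity of `∂_b∂_aΓ₀` in `b` (`newtonNearGradPotentialDeriv_apply`); the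
basis form makes the definition hypothesis-free. [folklore] -/
def newtonNearGradPotentialDeriv (r₀ r₁ : ℝ) (a : ℝ³) (f : ℝ³ → F) (x : ℝ³) : ℝ³ →L[ℝ] F :=
  ∑ i : Fin 3, (EuclideanSpace.proj i : ℝ³ →L[ℝ] ℝ).smulRight
    (czDiff (newtonNearHess r₀ r₁ a (EuclideanSpace.single i 1)) f x)

section Potential

variable [CompleteSpace F]

omit [CompleteSpace F] in
/-- The near gradient potential converges absolutely for continuous `f` (`∂_aΓ₀ ∈ L¹` vanishes
off the ball of radius `r₁`; `f` is bounded there). [folklore] -/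
theorem integrable_newtonNearGradPotential (h₀ : 0 < r₀) (h₁ : r₀ < r₁) (a : ℝ³) {f : ℝ³ → F}
    (hf : Continuous f) (x : ℝ³) :
    Integrable fun y => newtonNearGrad r₀ r₁ a (x - y) • f y :=
  integrable_kernel_sub_smul (integrable_newtonNearGrad h₀ h₁ a)
    (fun _ hz => newtonNearGrad_eq_zero_of_lt h₀.le h₁ a hz) hf x

/-- The regularised potential `u_d(x) = ∫ G_d(x − y) • f(y) dy` is differentiable, with
`∂_b u_d(x) = ∫ ∂_bG_d(x − y) • f(y) dy`. [folklore] -/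
theorem fderiv_truncPotential_apply (h₀ : 0 < r₀) (h₁ : r₀ < r₁) {d : ℝ} (hd : 0 < d) (a : ℝ³)
    {f : ℝ³ → F} (hf : Continuous f) (x b : ℝ³) :
    fderiv ℝ (fun x => ∫ y, newtonNearGradTrunc r₀ r₁ d a (x - y) • f y) x b =
      ∫ y, fderiv ℝ (newtonNearGradTrunc r₀ r₁ d a) (x - y) b • f y :=
  fderiv_integral_kernel_sub_smul_apply (contDiff_newtonNearGradTrunc h₀ h₁ hd a)
    (hasCompactSupport_newtonNearGradTrunc h₀ h₁ d a) hf x b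

/-- `y ↦ ∂_bG_d(x − y)` is continuous with compact support. [folklore] -/
theorem continuous_hasCompactSupport_fderiv_trunc_comp_sub (h₀ : 0 < r₀) (h₁ : r₀ < r₁) {d : ℝ}
    (hd : 0 < d) (a b x : ℝ³) :
    Continuous (fun y : ℝ³ => fderiv ℝ (newtonNearGradTrunc r₀ r₁ d a) (x - y) b) ∧
      HasCompactSupport (fun y : ℝ³ => fderiv ℝ (newtonNearGradTrunc r₀ r₁ d a) (x - y) b) := by
  have hc : Continuous fun z : ℝ³ => fderiv ℝ (newtonNearGradTrunc r₀ r₁ d a) z b :=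
    ((contDiff_newtonNearGradTrunc h₀ h₁ hd a).continuous_fderiv one_ne_zero).clm_apply
      continuous_const
  have hcs : HasCompactSupport fun z : ℝ³ => fderiv ℝ (newtonNearGradTrunc r₀ r₁ d a) z b :=
    (hasCompactSupport_newtonNearGradTrunc h₀ h₁ d a).fderiv_apply (𝕜 := ℝ) b
  refine ⟨hc.comp (continuous_const.sub continuous_id), ?_⟩
  exact hcs.comp_homeomorph (Homeomorph.subLeft x)

/-- **`∂_b u_d(x) = ∫ ∂_bG_d(x − y) • (f(y) − f(x)) dy`** (subtract `f(x) ∫ ∂_bG_d(x − y) dy = 0`).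
[folklore] -/
theorem fderiv_truncPotential_apply_eq_integral_sub (h₀ : 0 < r₀) (h₁ : r₀ < r₁) {d : ℝ}
    (hd : 0 < d) (a : ℝ³) {f : ℝ³ → F} (hf : Continuous f) (x b : ℝ³) :
    fderiv ℝ (fun x => ∫ y, newtonNearGradTrunc r₀ r₁ d a (x - y) • f y) x b =
      ∫ y, fderiv ℝ (newtonNearGradTrunc r₀ r₁ d a) (x - y) b • (f y - f x) := by
  obtain ⟨hc, hcs⟩ := continuous_hasCompactSupport_fderiv_trunc_comp_sub h₀ h₁ hd a b x
  have I1 : Integrable fun y => fderiv ℝ (newtonNearGradTrunc r₀ r₁ d a) (x - y) b • f y :=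
    (hc.smul hf).integrable_of_hasCompactSupport hcs.smul_right
  have I2 : Integrable fun y => fderiv ℝ (newtonNearGradTrunc r₀ r₁ d a) (x - y) b • f x :=
    (hc.smul continuous_const).integrable_of_hasCompactSupport hcs.smul_right
  have h0 : ∫ y, fderiv ℝ (newtonNearGradTrunc r₀ r₁ d a) (x - y) b • f x = 0 := by
    rw [integral_smul_const, integral_sub_left_eq_self
      (fun z => fderiv ℝ (newtonNearGradTrunc r₀ r₁ d a) z b) volume x,
      integral_fderiv_newtonNearGradTrunc_apply h₀ h₁ hd a b, zero_smul]
  rw [fderiv_truncPotential_apply h₀ h₁ hd a hf x b]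
  have e : ∀ y, fderiv ℝ (newtonNearGradTrunc r₀ r₁ d a) (x - y) b • (f y - f x) =
      fderiv ℝ (newtonNearGradTrunc r₀ r₁ d a) (x - y) b • f y -
        fderiv ℝ (newtonNearGradTrunc r₀ r₁ d a) (x - y) b • f x := fun y => smul_sub _ _ _
  simp_rw [e]
  rw [integral_sub I1 I2, h0, sub_zero]

/-- **Uniform closeness of `∂_b u_d` to the singular integral**: for a `γ`-Hölder `f` with
constant `C_f`, `0 < γ < 1`, and `0 < d`,
`‖∂_b u_d(x) − S_{ab}f(x)‖ ≤ C_f ‖a‖‖b‖ · 3|B₁| · (16 M_θ C₁ + 4C₂/γ) d^γ` for every `x`. [folklore] -/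
theorem norm_fderiv_truncPotential_sub_czDiff_le (h₀ : 0 < r₀) (h₁ : r₀ < r₁) {d : ℝ}
    (hd : 0 < d) {M C₁ C₂ A B A₀ : ℝ} (hM0 : 0 ≤ M)
    (hM : ∀ u : ℝ³, ‖fderiv ℝ (radialCutoff 2 3 : ℝ³ → ℝ) u‖ ≤ M) (hC₁0 : 0 ≤ C₁)
    (hC₁ : ∀ a z : ℝ³, |newtonNearGrad r₀ r₁ a z| ≤ C₁ * ‖a‖ * ‖z‖ ^ (-(2 : ℝ))) (hC₂0 : 0 ≤ C₂)
    (hC₂ : ∀ a b z : ℝ³, |newtonNearHess r₀ r₁ a b z| ≤ C₂ * ‖a‖ * ‖b‖ * ‖z‖ ^ (-(3 : ℝ)))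
    {a b : ℝ³} (hK : IsHolderCZKernel (newtonNearHess r₀ r₁ a b) r₁ A B A₀)
    {f : ℝ³ → F} {Cf γ : ℝ≥0} (hf : HolderWith Cf γ f) (hγ : 0 < γ) (hγ1 : γ < 1) (x : ℝ³) :
    ‖fderiv ℝ (fun x => ∫ y, newtonNearGradTrunc r₀ r₁ d a (x - y) • f y) x b -
        czDiff (newtonNearHess r₀ r₁ a b) f x‖ ≤
      Cf * ‖a‖ * ‖b‖ * (3 * (volume : Measure ℝ³).real (ball 0 1)) *
        (16 * M * C₁ + 4 * C₂ / γ) * d ^ (γ : ℝ) := by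
  have hγ' : (0 : ℝ) < γ := by exact_mod_cast hγ
  have hγ1' : (γ : ℝ) < 1 := by exact_mod_cast hγ1
  have hfc : Continuous f := hf.continuous hγ
  set c₃ : ℝ := 3 * (volume : Measure ℝ³).real (ball 0 1) with hc₃
  have hc₃0 : 0 ≤ c₃ := three_mul_volume_real_ball_nonneg
  obtain ⟨hc, hcs⟩ := continuous_hasCompactSupport_fderiv_trunc_comp_sub h₀ h₁ hd a b x
  -- the difference as one integral against the error kernel
  have I1 : Integrable fun y =>
      fderiv ℝ (newtonNearGradTrunc r₀ r₁ d a) (x - y) b • (f y - f x) :=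
    (hc.smul (hfc.sub continuous_const)).integrable_of_hasCompactSupport hcs.smul_right
  have I2 : Integrable fun y => newtonNearHess r₀ r₁ a b (x - y) • (f y - f x) :=
    hK.integrable_czDiff hf hγ hγ1 x
  have hdiff : fderiv ℝ (fun x => ∫ y, newtonNearGradTrunc r₀ r₁ d a (x - y) • f y) x b -
      czDiff (newtonNearHess r₀ r₁ a b) f x =
      ∫ y, (fderiv ℝ (newtonNearGradTrunc r₀ r₁ d a) (x - y) b -
        newtonNearHess r₀ r₁ a b (x - y)) • (f y - f x) := by
    rw [fderiv_truncPotential_apply_eq_integral_sub h₀ h₁ hd a hfc x b, czDiff,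
      ← integral_sub I1 I2]
    refine integral_congr_ae (Eventually.of_forall fun y => ?_)
    simp only [sub_smul]
  rw [hdiff]
  -- pointwise majorant by the two radial weights on the ball `B(x, 4d)`
  set K₁ : ℝ := M * d⁻¹ * ‖b‖ * (C₁ * ‖a‖) * Cf with hK₁
  set K₂ : ℝ := C₂ * ‖a‖ * ‖b‖ * Cf with hK₂
  have hK₁0 : 0 ≤ K₁ := by positivity
  have hK₂0 : 0 ≤ K₂ := by positivity
  have hpt : ∀ y, ‖(fderiv ℝ (newtonNearGradTrunc r₀ r₁ d a) (x - y) b -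
      newtonNearHess r₀ r₁ a b (x - y)) • (f y - f x)‖ₑ ≤
      (ball x (4 * d)).indicator (fun y => ENNReal.ofReal K₁ *
          ENNReal.ofReal (‖x - y‖ ^ ((γ : ℝ) - 2))) y +
        (ball x (4 * d)).indicator (fun y => ENNReal.ofReal K₂ *
          ENNReal.ofReal (‖x - y‖ ^ ((γ : ℝ) - 3))) y := by
    intro y
    have hE := abs_fderiv_newtonNearGradTrunc_sub_newtonNearHess_le (r₀ := r₀) (r₁ := r₁) hd hM
      hC₁ hC₂ a b (x - y)
    by_cases hy : y ∈ ball x (4 * d)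
    · have hz : x - y ∈ ball (0 : ℝ³) (4 * d) := by
        rw [mem_ball_zero_iff, ← dist_eq_norm, dist_comm]; exact hy
      rw [indicator_of_mem hz] at hE
      rw [indicator_of_mem hy, indicator_of_mem hy, ← ENNReal.ofReal_mul hK₁0,
        ← ENNReal.ofReal_mul hK₂0, ← ENNReal.ofReal_add (by positivity) (by positivity),
        ← ofReal_norm]
      refine ENNReal.ofReal_le_ofReal ?_
      rw [norm_smul, Real.norm_eq_abs]
      have hfy := holder_norm_sub_le hf x y
      have hγ2 : (-2 : ℝ) + γ ≠ 0 := by linarith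
      have hγ3 : (-3 : ℝ) + γ ≠ 0 := by linarith
      calc |fderiv ℝ (newtonNearGradTrunc r₀ r₁ d a) (x - y) b - newtonNearHess r₀ r₁ a b (x - y)| *
            ‖f y - f x‖
          ≤ (M * d⁻¹ * ‖b‖ * (C₁ * ‖a‖ * ‖x - y‖ ^ (-(2 : ℝ))) +
              C₂ * ‖a‖ * ‖b‖ * ‖x - y‖ ^ (-(3 : ℝ))) * (Cf * ‖x - y‖ ^ (γ : ℝ)) :=
            mul_le_mul hE hfy (norm_nonneg _) (by positivity)
        _ = K₁ * (‖x - y‖ ^ (-(2 : ℝ)) * ‖x - y‖ ^ (γ : ℝ)) +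
              K₂ * (‖x - y‖ ^ (-(3 : ℝ)) * ‖x - y‖ ^ (γ : ℝ)) := by rw [hK₁, hK₂]; ring
        _ = K₁ * ‖x - y‖ ^ ((γ : ℝ) - 2) + K₂ * ‖x - y‖ ^ ((γ : ℝ) - 3) := by
            rw [← Real.rpow_add' (norm_nonneg _) hγ2, ← Real.rpow_add' (norm_nonneg _) hγ3]
            congr 2 <;> ring
    · have hz : x - y ∉ ball (0 : ℝ³) (4 * d) := by
        rw [mem_ball_zero_iff, ← dist_eq_norm, dist_comm]; exact hy
      rw [indicator_of_notMem hz] at hE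
      have h0 : fderiv ℝ (newtonNearGradTrunc r₀ r₁ d a) (x - y) b -
          newtonNearHess r₀ r₁ a b (x - y) = 0 := abs_nonpos_iff.1 hE
      rw [h0, zero_smul, enorm_zero]
      exact bot_le
  -- integrate the majorant
  have hmeas2 : Measurable fun y : ℝ³ => ENNReal.ofReal (‖x - y‖ ^ ((γ : ℝ) - 2)) :=
    ((continuous_const.sub continuous_id).norm.measurable.pow_const _).ennreal_ofReal
  have hmeas3 : Measurable fun y : ℝ³ => ENNReal.ofReal (‖x - y‖ ^ ((γ : ℝ) - 3)) :=
    ((continuous_const.sub continuous_id).norm.measurable.pow_const _).ennreal_ofReal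
  have h4d : 0 < 4 * d := by positivity
  have hint : ∫⁻ y, ((ball x (4 * d)).indicator (fun y => ENNReal.ofReal K₁ *
          ENNReal.ofReal (‖x - y‖ ^ ((γ : ℝ) - 2))) y +
        (ball x (4 * d)).indicator (fun y => ENNReal.ofReal K₂ *
          ENNReal.ofReal (‖x - y‖ ^ ((γ : ℝ) - 3))) y) =
      ENNReal.ofReal (K₁ * (c₃ * ((4 * d) ^ ((γ : ℝ) + 1) / (γ + 1))) +
        K₂ * (c₃ * ((4 * d) ^ (γ : ℝ) / γ))) := by
    rw [lintegral_add_left ((hmeas2.const_mul _).indicator measurableSet_ball),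
      lintegral_indicator measurableSet_ball, lintegral_indicator measurableSet_ball,
      lintegral_const_mul _ hmeas2, lintegral_const_mul _ hmeas3,
      lintegral_ball_norm_sub_rpow_sub_two (by linarith) x h4d,
      lintegral_ball_norm_sub_rpow hγ' x h4d, ← ENNReal.ofReal_mul hK₁0,
      ← ENNReal.ofReal_mul hK₂0, ← ENNReal.ofReal_add (by positivity) (by positivity)]
  have h1 : ‖∫ y, (fderiv ℝ (newtonNearGradTrunc r₀ r₁ d a) (x - y) b -
      newtonNearHess r₀ r₁ a b (x - y)) • (f y - f x)‖ₑ ≤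
      ENNReal.ofReal (K₁ * (c₃ * ((4 * d) ^ ((γ : ℝ) + 1) / (γ + 1))) +
        K₂ * (c₃ * ((4 * d) ^ (γ : ℝ) / γ))) := by
    rw [← hint]
    exact (enorm_integral_le_lintegral_enorm _).trans (lintegral_mono hpt)
  rw [← ofReal_norm, ENNReal.ofReal_le_ofReal_iff (by positivity)] at h1
  refine h1.trans ?_
  -- elementary: `(4d)^{γ+1} ≤ 16 d d^γ`, `(4d)^γ ≤ 4 d^γ`, `1/(γ+1) ≤ 1`
  set D : ℝ := d ^ (γ : ℝ) with hD
  have hD0 : 0 ≤ D := Real.rpow_nonneg hd.le _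
  have p1 : (4 * d) ^ ((γ : ℝ) + 1) ≤ 16 * (d * D) := by
    rw [Real.mul_rpow (by norm_num) hd.le, Real.rpow_add hd, Real.rpow_one, hD]
    have h4 : (4 : ℝ) ^ ((γ : ℝ) + 1) ≤ (4 : ℝ) ^ (2 : ℝ) :=
      Real.rpow_le_rpow_of_exponent_le (by norm_num) (by linarith)
    have h16 : (4 : ℝ) ^ (2 : ℝ) = 16 := by norm_num
    rw [h16] at h4
    calc (4 : ℝ) ^ ((γ : ℝ) + 1) * (d ^ (γ : ℝ) * d) ≤ 16 * (d ^ (γ : ℝ) * d) :=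
          mul_le_mul_of_nonneg_right h4 (by positivity)
      _ = 16 * (d * d ^ (γ : ℝ)) := by ring
  have p2 : (4 * d) ^ (γ : ℝ) ≤ 4 * D := by
    rw [Real.mul_rpow (by norm_num) hd.le, hD]
    refine mul_le_mul_of_nonneg_right ?_ hD0
    calc (4 : ℝ) ^ (γ : ℝ) ≤ (4 : ℝ) ^ (1 : ℝ) :=
          Real.rpow_le_rpow_of_exponent_le (by norm_num) hγ1'.le
      _ = 4 := Real.rpow_one 4
  have q1 : K₁ * (c₃ * ((4 * d) ^ ((γ : ℝ) + 1) / (γ + 1))) ≤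
      Cf * ‖a‖ * ‖b‖ * c₃ * (16 * M * C₁) * D := by
    have hγ1pos : (1 : ℝ) ≤ γ + 1 := by linarith
    have step : (4 * d) ^ ((γ : ℝ) + 1) / (γ + 1) ≤ 16 * (d * D) :=
      (div_le_self (Real.rpow_nonneg h4d.le _) hγ1pos).trans p1
    calc K₁ * (c₃ * ((4 * d) ^ ((γ : ℝ) + 1) / (γ + 1))) ≤ K₁ * (c₃ * (16 * (d * D))) := by
          gcongr
      _ = Cf * ‖a‖ * ‖b‖ * c₃ * (16 * M * C₁) * D * (d⁻¹ * d) := by rw [hK₁]; ring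
      _ = Cf * ‖a‖ * ‖b‖ * c₃ * (16 * M * C₁) * D := by rw [inv_mul_cancel₀ hd.ne', mul_one]
  have q2 : K₂ * (c₃ * ((4 * d) ^ (γ : ℝ) / γ)) ≤ Cf * ‖a‖ * ‖b‖ * c₃ * (4 * C₂ / γ) * D := by
    have step : (4 * d) ^ (γ : ℝ) / γ ≤ 4 * D / γ := div_le_div_of_nonneg_right p2 hγ'.le
    calc K₂ * (c₃ * ((4 * d) ^ (γ : ℝ) / γ)) ≤ K₂ * (c₃ * (4 * D / γ)) := by gcongr
      _ = Cf * ‖a‖ * ‖b‖ * c₃ * (4 * C₂ / γ) * D := by rw [hK₂]; ring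
  calc K₁ * (c₃ * ((4 * d) ^ ((γ : ℝ) + 1) / (γ + 1))) + K₂ * (c₃ * ((4 * d) ^ (γ : ℝ) / γ))
      ≤ Cf * ‖a‖ * ‖b‖ * c₃ * (16 * M * C₁) * D + Cf * ‖a‖ * ‖b‖ * c₃ * (4 * C₂ / γ) * D :=
        add_le_add q1 q2
    _ = Cf * ‖a‖ * ‖b‖ * c₃ * (16 * M * C₁ + 4 * C₂ / γ) * D := by ring

omit [CompleteSpace F] in
/-- **Pointwise closeness of `u_d` to `T⁰_a f`**: if `‖f‖ ≤ M_f` on the ball `B(x, 4d)`, then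
`‖u_d(x) − T⁰_a f(x)‖ ≤ C₁‖a‖ M_f · 3|B₁| · 4d` (the difference is
`−∫ θ₂₃(d⁻¹(x−y)) ∂_aΓ₀(x−y) • f(y) dy`, supported in `|x − y| < 4d`). [folklore] -/
theorem norm_truncPotential_sub_newtonNearGradPotential_le (h₀ : 0 < r₀) (h₁ : r₀ < r₁) {d : ℝ}
    (hd : 0 < d) {C₁ : ℝ} (hC₁0 : 0 ≤ C₁)
    (hC₁ : ∀ a z : ℝ³, |newtonNearGrad r₀ r₁ a z| ≤ C₁ * ‖a‖ * ‖z‖ ^ (-(2 : ℝ))) (a : ℝ³)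
    {f : ℝ³ → F} (hf : Continuous f) (x : ℝ³) {Mf : ℝ} (hMf0 : 0 ≤ Mf)
    (hMf : ∀ y ∈ ball x (4 * d), ‖f y‖ ≤ Mf) :
    ‖(∫ y, newtonNearGradTrunc r₀ r₁ d a (x - y) • f y) - newtonNearGradPotential r₀ r₁ a f x‖ ≤
      C₁ * ‖a‖ * Mf * (3 * (volume : Measure ℝ³).real (ball 0 1)) * (4 * d) := by
  set c₃ : ℝ := 3 * (volume : Measure ℝ³).real (ball 0 1) with hc₃
  have I1 : Integrable fun y => newtonNearGradTrunc r₀ r₁ d a (x - y) • f y :=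
    integrable_kernel_sub_smul_of_continuous (contDiff_newtonNearGradTrunc h₀ h₁ hd a).continuous
      (hasCompactSupport_newtonNearGradTrunc h₀ h₁ d a) (ContinuousLinearMap.lsmul ℝ ℝ) hf x
  have I2 := integrable_newtonNearGradPotential h₀ h₁ a hf x
  have hdiff : (∫ y, newtonNearGradTrunc r₀ r₁ d a (x - y) • f y) -
      newtonNearGradPotential r₀ r₁ a f x =
      ∫ y, (-(radialCutoff 2 3 (d⁻¹ • ((x - y) + 0)) * newtonNearGrad r₀ r₁ a (x - y))) • f y := by
    rw [newtonNearGradPotential, ← integral_sub I1 I2]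
    refine integral_congr_ae (Eventually.of_forall fun y => ?_)
    show newtonNearGradTrunc r₀ r₁ d a (x - y) • f y - newtonNearGrad r₀ r₁ a (x - y) • f y = _
    rw [← sub_smul, newtonNearGradTrunc]
    congr 1
    ring
  rw [hdiff]
  have K0 : 0 ≤ C₁ * ‖a‖ * Mf := by positivity
  have hpt : ∀ y, ‖(-(radialCutoff 2 3 (d⁻¹ • ((x - y) + 0)) * newtonNearGrad r₀ r₁ a (x - y))) •
      f y‖ₑ ≤ (ball x (4 * d)).indicator
        (fun y => ENNReal.ofReal (C₁ * ‖a‖ * Mf * ‖x - y‖ ^ ((1 : ℝ) - 3))) y := by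
    intro y
    by_cases hy : y ∈ ball x (4 * d)
    · rw [indicator_of_mem hy, ← ofReal_norm]
      refine ENNReal.ofReal_le_ofReal ?_
      rw [norm_smul, norm_neg, norm_mul, Real.norm_eq_abs, Real.norm_eq_abs,
        show ((1 : ℝ) - 3) = -2 by norm_num]
      calc |radialCutoff 2 3 (d⁻¹ • ((x - y) + 0))| * |newtonNearGrad r₀ r₁ a (x - y)| * ‖f y‖
          ≤ 1 * (C₁ * ‖a‖ * ‖x - y‖ ^ (-(2 : ℝ))) * Mf := by
            refine mul_le_mul (mul_le_mul (abs_radialCutoff_le_one 2 3 _) (hC₁ a (x - y))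
              (abs_nonneg _) zero_le_one) (hMf y hy) (norm_nonneg _) (by positivity)
        _ = C₁ * ‖a‖ * Mf * ‖x - y‖ ^ (-2 : ℝ) := by ring
    · rw [indicator_of_notMem hy]
      rw [mem_ball, dist_eq_norm, norm_sub_rev, not_lt] at hy
      rw [radialCutoff_eq_zero (by norm_num) (by norm_num) ?_, zero_mul, neg_zero, zero_smul,
        enorm_zero]
      rw [norm_smul_add_eq hd, le_inv_mul_iff₀ hd, add_zero]
      linarith
  have h1 := norm_integral_le_of_indicator_ball (p := x) (γ' := 1) one_pos (by positivity) K0 hpt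
  rw [Real.rpow_one, div_one] at h1
  exact h1

/-! ### The candidate derivative is `b ↦ S_{ab}f(x)` -/

/-- `∂_b∂_aΓ₀` is linear in `b` (it is `D²Γ₀(z) b a`): additivity. [folklore] -/
theorem newtonNearHess_add_right (r₀ r₁ : ℝ) (a b b' z : ℝ³) :
    newtonNearHess r₀ r₁ a (b + b') z = newtonNearHess r₀ r₁ a b z + newtonNearHess r₀ r₁ a b' z := by
  rw [newtonNearHess, newtonNearHess, newtonNearHess, map_add, add_apply]

/-- `∂_b∂_aΓ₀` is linear in `b`: homogeneity. [folklore] -/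
theorem newtonNearHess_smul_right (r₀ r₁ : ℝ) (c : ℝ) (a b z : ℝ³) :
    newtonNearHess r₀ r₁ a (c • b) z = c * newtonNearHess r₀ r₁ a b z := by
  rw [newtonNearHess, newtonNearHess, map_smul, smul_apply, smul_eq_mul]

/-- The expansion of a vector of `ℝ³` in the standard basis. [folklore] -/
theorem eq_sum_single (b : ℝ³) : b = ∑ i : Fin 3, b i • EuclideanSpace.single i (1 : ℝ) := by
  ext j
  simp [Fin.sum_univ_three]
  fin_cases j <;> simp

/-- `∂_b∂_aΓ₀ = Σᵢ bᵢ ∂_{eᵢ}∂_aΓ₀`. [folklore] -/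
theorem newtonNearHess_eq_sum (r₀ r₁ : ℝ) (a b z : ℝ³) :
    newtonNearHess r₀ r₁ a b z =
      ∑ i : Fin 3, b i * newtonNearHess r₀ r₁ a (EuclideanSpace.single i 1) z := by
  conv_lhs => rw [eq_sum_single b]
  rw [newtonNearHess, map_sum, FunLike.coe_sum, Finset.sum_apply]
  refine Finset.sum_congr rfl fun i _ => ?_
  rw [map_smul, smul_apply, smul_eq_mul, newtonNearHess]

omit [CompleteSpace F] in
/-- **The candidate derivative evaluates to the singular integral**:
`(newtonNearGradPotentialDeriv … x) b = S_{ab}f(x)` (linearity of `∂_b∂_aΓ₀` in `b` and of the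
absolutely convergent integrals). [folklore] -/
theorem newtonNearGradPotentialDeriv_apply (h₀ : 0 < r₀) (h₁ : r₀ < r₁) (a : ℝ³) {f : ℝ³ → F}
    {Cf γ : ℝ≥0} (hf : HolderWith Cf γ f) (hγ : 0 < γ) (hγ1 : γ < 1) (x b : ℝ³) :
    newtonNearGradPotentialDeriv r₀ r₁ a f x b = czDiff (newtonNearHess r₀ r₁ a b) f x := by
  obtain ⟨A, B, A₀, -, -, -, hK⟩ := exists_isHolderCZKernel_newtonNearHess h₀ h₁
  have hI : ∀ i : Fin 3, Integrable fun y =>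
      newtonNearHess r₀ r₁ a (EuclideanSpace.single i 1) (x - y) • (f y - f x) := fun i =>
    (hK a _).integrable_czDiff hf hγ hγ1 x
  rw [newtonNearGradPotentialDeriv, FunLike.coe_sum, Finset.sum_apply]
  simp only [ContinuousLinearMap.smulRight_apply]
  have hp : ∀ i : Fin 3, (EuclideanSpace.proj i : ℝ³ →L[ℝ] ℝ) b = b i := fun i => rfl
  simp only [hp]
  rw [czDiff]
  have e : ∀ y, newtonNearHess r₀ r₁ a b (x - y) • (f y - f x) =
      ∑ i : Fin 3, b i • (newtonNearHess r₀ r₁ a (EuclideanSpace.single i 1) (x - y) •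
        (f y - f x)) := fun y => by
    rw [newtonNearHess_eq_sum, Finset.sum_smul]
    refine Finset.sum_congr rfl fun i _ => ?_
    rw [mul_smul]
  simp_rw [e]
  rw [integral_finsetSum _ fun i _ =>
    show Integrable (fun y => b i • (newtonNearHess r₀ r₁ a (EuclideanSpace.single i 1) (x - y) •
      (f y - f x))) from (hI i).smul (b i)]
  refine Finset.sum_congr rfl fun i _ => ?_
  rw [integral_smul, czDiff]

/-! ### Differentiability of the near gradient potential -/

/-- **The near gradient potential of a Hölder density is differentiable, with derivative the
singular integral on differences**: for `f` `γ`-Hölder, `0 < γ < 1`,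
`D(T⁰_a f)(x) = (b ↦ ∫ ∂_b∂_aΓ₀(x − y)(f(y) − f(x)) dy)` (Gilbarg–Trudinger, Lemma 4.2 with
(4.10), boundary-free). Proof by regularisation `G_d = (1 − θ₂₃(·/d))∂_aΓ₀`, `d = 1/(n+1)`:
uniform convergence of `D u_d` (`norm_fderiv_truncPotential_sub_czDiff_le`) and pointwise
convergence of `u_d` (`norm_truncPotential_sub_newtonNearGradPotential_le`), then
`hasFDerivAt_of_tendstoUniformly`. [cite: GilbargTrudinger2001, Lemma 4.2 with (4.10)] -/
theorem hasFDerivAt_newtonNearGradPotential (h₀ : 0 < r₀) (h₁ : r₀ < r₁) (a : ℝ³) {f : ℝ³ → F}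
    {Cf γ : ℝ≥0} (hf : HolderWith Cf γ f) (hγ : 0 < γ) (hγ1 : γ < 1) (x : ℝ³) :
    HasFDerivAt (newtonNearGradPotential r₀ r₁ a f)
      (newtonNearGradPotentialDeriv r₀ r₁ a f x) x := by
  have hγ' : (0 : ℝ) < γ := by exact_mod_cast hγ
  have hfc : Continuous f := hf.continuous hγ
  obtain ⟨M, hM0, hM⟩ := exists_norm_fderiv_radialCutoff_two_three_le
  obtain ⟨C₁, hC₁0, hC₁⟩ := exists_abs_newtonNearGrad_le h₀ h₁
  obtain ⟨C₂, hC₂0, hC₂⟩ := exists_abs_newtonNearHess_le h₀ h₁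
  obtain ⟨A, B, A₀, -, -, -, hK⟩ := exists_isHolderCZKernel_newtonNearHess h₀ h₁
  set c₃ : ℝ := 3 * (volume : Measure ℝ³).real (ball 0 1) with hc₃
  -- the regularisation sequence `d n = 1/(n+1)`
  set d : ℕ → ℝ := fun n => ((n : ℝ) + 1)⁻¹ with hd
  have hdpos : ∀ n, 0 < d n := fun n => by rw [hd]; positivity
  have hd1 : ∀ n, d n ≤ 1 := fun n => by
    rw [hd]
    exact inv_le_one_of_one_le₀ (by linarith [n.cast_nonneg (α := ℝ)])
  have hdlim : Tendsto d atTop (𝓝 0) := by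
    have h := tendsto_one_div_add_atTop_nhds_zero_nat (𝕜 := ℝ)
    refine h.congr' (Eventually.of_forall fun n => ?_)
    rw [hd, one_div]
  set u : ℕ → ℝ³ → F := fun n x => ∫ y, newtonNearGradTrunc r₀ r₁ (d n) a (x - y) • f y with hu
  -- derivatives of the regularised potentials
  have hderiv : ∀ n x, HasFDerivAt (u n) (fderiv ℝ (u n) x) x := fun n x =>
    (hasFDerivAt_integral_kernel_sub_smul (contDiff_newtonNearGradTrunc h₀ h₁ (hdpos n) a)
      (hasCompactSupport_newtonNearGradTrunc h₀ h₁ (d n) a) hfc x).differentiableAt.hasFDerivAt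
  -- uniform convergence of the derivatives
  set Kc : ℝ := Cf * ‖a‖ * c₃ * (16 * M * C₁ + 4 * C₂ / γ) with hKc
  have hKc0 : 0 ≤ Kc := by
    have := three_mul_volume_real_ball_nonneg
    positivity
  have hop : ∀ n x, ‖fderiv ℝ (u n) x - newtonNearGradPotentialDeriv r₀ r₁ a f x‖ ≤
      Kc * d n ^ (γ : ℝ) := fun n x => by
    refine ContinuousLinearMap.opNorm_le_bound _ (by positivity) fun b => ?_
    rw [sub_apply, newtonNearGradPotentialDeriv_apply h₀ h₁ a hf hγ hγ1 x b]
    have h := norm_fderiv_truncPotential_sub_czDiff_le h₀ h₁ (hdpos n) hM0 hM hC₁0 hC₁ hC₂0 hC₂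
      (hK a b) hf hγ hγ1 x
    calc ‖fderiv ℝ (u n) x b - czDiff (newtonNearHess r₀ r₁ a b) f x‖
        ≤ Cf * ‖a‖ * ‖b‖ * c₃ * (16 * M * C₁ + 4 * C₂ / γ) * d n ^ (γ : ℝ) := h
      _ = Kc * d n ^ (γ : ℝ) * ‖b‖ := by rw [hKc]; ring
  have hunif : TendstoUniformly (fun n x => fderiv ℝ (u n) x)
      (fun x => newtonNearGradPotentialDeriv r₀ r₁ a f x) atTop := by
    rw [Metric.tendstoUniformly_iff]
    intro ε hε
    have ht : Tendsto (fun n => Kc * d n ^ (γ : ℝ)) atTop (𝓝 0) := by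
      have h1 : Tendsto (fun n => d n ^ (γ : ℝ)) atTop (𝓝 0) := by
        have h0 : (0 : ℝ) ^ (γ : ℝ) = 0 := Real.zero_rpow hγ'.ne'
        rw [← h0]
        exact hdlim.rpow_const (Or.inr hγ'.le)
      simpa using h1.const_mul Kc
    filter_upwards [ht.eventually (gt_mem_nhds hε)] with n hn y
    rw [dist_comm, dist_eq_norm]
    exact (hop n y).trans_lt hn
  -- pointwise convergence of the regularised potentials
  have hptw : ∀ x, Tendsto (fun n => u n x) atTop
      (𝓝 (newtonNearGradPotential r₀ r₁ a f x)) := fun x => by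
    obtain ⟨Mf, hMf⟩ := (isCompact_closedBall x 4).exists_bound_of_continuousOn hfc.continuousOn
    have hMf0 : 0 ≤ Mf := (norm_nonneg _).trans (hMf x (mem_closedBall_self (by norm_num)))
    have hb : ∀ n, ‖u n x - newtonNearGradPotential r₀ r₁ a f x‖ ≤
        C₁ * ‖a‖ * Mf * c₃ * (4 * d n) := fun n =>
      norm_truncPotential_sub_newtonNearGradPotential_le h₀ h₁ (hdpos n) hC₁0 hC₁ a hfc x hMf0
        fun y hy => hMf y (by
          rw [mem_ball] at hy
          rw [mem_closedBall]
          have := hd1 n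
          linarith)
    rw [tendsto_iff_norm_sub_tendsto_zero]
    refine squeeze_zero (fun n => norm_nonneg _) hb ?_
    have : Tendsto (fun n => C₁ * ‖a‖ * Mf * c₃ * (4 * d n)) atTop
        (𝓝 (C₁ * ‖a‖ * Mf * c₃ * (4 * 0))) := (hdlim.const_mul 4).const_mul _
    simpa using this
  exact hasFDerivAt_of_tendstoUniformly hunif hderiv hptw x

/-- **The derivative of the near gradient potential** is `newtonNearGradPotentialDeriv`
(`= b ↦ S_{ab}f(x)`). [folklore] -/
theorem fderiv_newtonNearGradPotential (h₀ : 0 < r₀) (h₁ : r₀ < r₁) (a : ℝ³) {f : ℝ³ → F}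
    {Cf γ : ℝ≥0} (hf : HolderWith Cf γ f) (hγ : 0 < γ) (hγ1 : γ < 1) (x : ℝ³) :
    fderiv ℝ (newtonNearGradPotential r₀ r₁ a f) x = newtonNearGradPotentialDeriv r₀ r₁ a f x :=
  (hasFDerivAt_newtonNearGradPotential h₀ h₁ a hf hγ hγ1 x).fderiv

/-- `∂_b T⁰_a f(x) = S_{ab}f(x) = ∫ ∂_b∂_aΓ₀(x − y)(f(y) − f(x)) dy`. [cite: GilbargTrudinger2001, Lemma 4.2 with (4.10)] -/
theorem fderiv_newtonNearGradPotential_apply (h₀ : 0 < r₀) (h₁ : r₀ < r₁) (a : ℝ³) {f : ℝ³ → F}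
    {Cf γ : ℝ≥0} (hf : HolderWith Cf γ f) (hγ : 0 < γ) (hγ1 : γ < 1) (x b : ℝ³) :
    fderiv ℝ (newtonNearGradPotential r₀ r₁ a f) x b = czDiff (newtonNearHess r₀ r₁ a b) f x := by
  rw [fderiv_newtonNearGradPotential h₀ h₁ a hf hγ hγ1 x,
    newtonNearGradPotentialDeriv_apply h₀ h₁ a hf hγ hγ1 x b]

/-! ### Bounds: the near half of `|K₃ f|_{1,γ} ≤ c‖f‖_γ` -/

omit [CompleteSpace F] in
/-- **Sup bound for the near gradient potential of a bounded density**: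
`‖T⁰_a f(x)‖ ≤ C₁‖a‖ M_f · 3|B₁| · r₁` if `‖f‖ ≤ M_f` (Majda–Bertozzi Lemma 4.5, localised:
`|∂_aΓ₀(z)| ≤ C₁‖a‖|z|⁻²` on the ball of radius `r₁`). [cite: MajdaBertozziCUP2002, §4.1.3 Lemma 4.5 (4.34) (p. 129)] -/
theorem norm_newtonNearGradPotential_le (h₀ : 0 < r₀) (h₁ : r₀ < r₁) {C₁ : ℝ} (hC₁0 : 0 ≤ C₁)
    (hC₁ : ∀ a z : ℝ³, |newtonNearGrad r₀ r₁ a z| ≤ C₁ * ‖a‖ * ‖z‖ ^ (-(2 : ℝ))) (a : ℝ³)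
    {f : ℝ³ → F} {Mf : ℝ} (hMf0 : 0 ≤ Mf) (hMf : ∀ y, ‖f y‖ ≤ Mf) (x : ℝ³) :
    ‖newtonNearGradPotential r₀ r₁ a f x‖ ≤
      C₁ * ‖a‖ * Mf * (3 * (volume : Measure ℝ³).real (ball 0 1)) * r₁ := by
  have hr₁ : 0 < r₁ := h₀.trans h₁
  have K0 : 0 ≤ C₁ * ‖a‖ * Mf := by positivity
  have hpt : ∀ y, ‖newtonNearGrad r₀ r₁ a (x - y) • f y‖ₑ ≤ (ball x r₁).indicator
      (fun y => ENNReal.ofReal (C₁ * ‖a‖ * Mf * ‖x - y‖ ^ ((1 : ℝ) - 3))) y := by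
    intro y
    by_cases hy : y ∈ ball x r₁
    · rw [indicator_of_mem hy, ← ofReal_norm]
      refine ENNReal.ofReal_le_ofReal ?_
      rw [norm_smul, Real.norm_eq_abs, show ((1 : ℝ) - 3) = -2 by norm_num]
      calc |newtonNearGrad r₀ r₁ a (x - y)| * ‖f y‖ ≤ (C₁ * ‖a‖ * ‖x - y‖ ^ (-(2 : ℝ))) * Mf :=
            mul_le_mul (hC₁ a (x - y)) (hMf y) (norm_nonneg _) (by positivity)
        _ = C₁ * ‖a‖ * Mf * ‖x - y‖ ^ (-2 : ℝ) := by ring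
    · rw [indicator_of_notMem hy]
      rw [mem_ball, dist_eq_norm, norm_sub_rev, not_lt] at hy
      rw [newtonNearGrad_eq_zero_of_le h₀ h₁ a hy, zero_smul, enorm_zero]
  have h1 := norm_integral_le_of_indicator_ball (p := x) (γ' := 1) one_pos hr₁ K0 hpt
  rw [Real.rpow_one, div_one] at h1
  exact h1

/-- **Bounds for the derivative of the near gradient potential** (the near half of
Majda–Bertozzi's (4.39) `|K₃f|_{1,γ} ≤ c‖f‖_γ`, from Lemma 4.6): there is `C = C(r₀, r₁)` with
`‖D T⁰_a f(x)‖ ≤ C‖a‖C_f r₁^γ/γ` and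
`‖D T⁰_a f(x) − D T⁰_a f(x̄)‖ ≤ C‖a‖C_f(γ⁻¹ + (1−γ)⁻¹ + 1)|x − x̄|^γ` for every `γ`-Hölder `f`
with constant `C_f`, `0 < γ < 1`. [cite: MajdaBertozziCUP2002, §4.1.3 Lemma 4.6 (4.36) and (4.39) (p. 129)] -/
theorem exists_newtonNearGradPotentialDeriv_bounds (h₀ : 0 < r₀) (h₁ : r₀ < r₁) :
    ∃ C : ℝ, 0 ≤ C ∧ ∀ (a : ℝ³) (f : ℝ³ → F) (Cf γ : ℝ≥0), HolderWith Cf γ f → 0 < γ → γ < 1 →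
      (∀ x, ‖newtonNearGradPotentialDeriv r₀ r₁ a f x‖ ≤ C * ‖a‖ * Cf * (r₁ ^ (γ : ℝ) / γ)) ∧
      ∀ x x', ‖newtonNearGradPotentialDeriv r₀ r₁ a f x - newtonNearGradPotentialDeriv r₀ r₁ a f x'‖ ≤
        C * ‖a‖ * Cf * (1 / γ + 1 / (1 - γ) + 1) * ‖x - x'‖ ^ (γ : ℝ) := by
  obtain ⟨C, hC0, hC⟩ := exists_holder_bounds_czDiff_newtonNearHess (F := F) h₀ h₁
  refine ⟨C, hC0, fun a f Cf γ hf hγ hγ1 => ⟨fun x => ?_, fun x x' => ?_⟩⟩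
  · have hγ' : (0 : ℝ) < γ := by exact_mod_cast hγ
    have hr₁ : 0 < r₁ := h₀.trans h₁
    refine ContinuousLinearMap.opNorm_le_bound _ (by positivity) fun b => ?_
    rw [newtonNearGradPotentialDeriv_apply h₀ h₁ a hf hγ hγ1 x b]
    calc ‖czDiff (newtonNearHess r₀ r₁ a b) f x‖ ≤ C * ‖a‖ * ‖b‖ * Cf * (r₁ ^ (γ : ℝ) / γ) :=
          ((hC a b f Cf γ hf hγ hγ1).1 x)
      _ = C * ‖a‖ * Cf * (r₁ ^ (γ : ℝ) / γ) * ‖b‖ := by ring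
  · have hγ' : (0 : ℝ) < γ := by exact_mod_cast hγ
    have hγ1' : (γ : ℝ) < 1 := by exact_mod_cast hγ1
    have h1γ : 0 < 1 - (γ : ℝ) := by linarith
    refine ContinuousLinearMap.opNorm_le_bound _ (by positivity) fun b => ?_
    rw [sub_apply, newtonNearGradPotentialDeriv_apply h₀ h₁ a hf hγ hγ1 x b,
      newtonNearGradPotentialDeriv_apply h₀ h₁ a hf hγ hγ1 x' b]
    calc ‖czDiff (newtonNearHess r₀ r₁ a b) f x - czDiff (newtonNearHess r₀ r₁ a b) f x'‖
        ≤ C * ‖a‖ * ‖b‖ * Cf * (1 / γ + 1 / (1 - γ) + 1) * ‖x - x'‖ ^ (γ : ℝ) :=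
          (hC a b f Cf γ hf hγ hγ1).2 x x'
      _ = C * ‖a‖ * Cf * (1 / γ + 1 / (1 - γ) + 1) * ‖x - x'‖ ^ (γ : ℝ) * ‖b‖ := by ring

/-- **The near gradient potential of a Hölder density is `C¹`** (its derivative is even
`γ`-Hölder, `exists_newtonNearGradPotentialDeriv_bounds`). [folklore] -/
theorem contDiff_one_newtonNearGradPotential (h₀ : 0 < r₀) (h₁ : r₀ < r₁) (a : ℝ³) {f : ℝ³ → F}
    {Cf γ : ℝ≥0} (hf : HolderWith Cf γ f) (hγ : 0 < γ) (hγ1 : γ < 1) :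
    ContDiff ℝ 1 (newtonNearGradPotential r₀ r₁ a f) := by
  obtain ⟨C, hC0, hC⟩ := exists_newtonNearGradPotentialDeriv_bounds (F := F) h₀ h₁
  have hγ' : (0 : ℝ) < γ := by exact_mod_cast hγ
  have hγ1' : (γ : ℝ) < 1 := by exact_mod_cast hγ1
  have h1γ : 0 < 1 - (γ : ℝ) := by linarith
  have hD : fderiv ℝ (newtonNearGradPotential r₀ r₁ a f) = newtonNearGradPotentialDeriv r₀ r₁ a f :=
    funext fun x => fderiv_newtonNearGradPotential h₀ h₁ a hf hγ hγ1 x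
  set K : ℝ := C * ‖a‖ * Cf * (1 / γ + 1 / (1 - γ) + 1) with hK
  have hK0 : 0 ≤ K := by positivity
  have hHolder : HolderWith (Real.toNNReal K) γ (newtonNearGradPotentialDeriv r₀ r₁ a f) := by
    refine FunctionSpaces.holderWith_of_dist_le fun x x' => ?_
    rw [dist_eq_norm, dist_eq_norm, Real.coe_toNNReal _ hK0]
    exact (hC a f Cf γ hf hγ hγ1).2 x x'
  rw [contDiff_one_iff_fderiv, hD]
  exact ⟨fun x => (hasFDerivAt_newtonNearGradPotential h₀ h₁ a hf hγ hγ1 x).differentiableAt,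
    hHolder.continuous hγ⟩

end Potential

end Literature.Analysis.FluidPDE
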